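import Summits.AtomisticToContinuum.Crystallization.Theorems.OverbindingBudgetTwoShellSeam
import Summits.AtomisticToContinuum.Crystallization.Theorems.OverbindingBudgetTwoShellCoverDirections
import Summits.AtomisticToContinuum.Crystallization.Theorems.FrustratedLawDichotomyLinkCert
import Summits.AtomisticToContinuum.Crystallization.Theorems.FrustratedLawDichotomyCappedCertBoth

/-!
# OverbindingBudget — two-shell coverage, part 2: the coverage piece PROVED, and the slot-3 producer

Helper file (`--supports stmt-AtomisticToContinuum-31280`, lens-3 g29).  It closes the one piece of the two-shell seam
(`OverbindingBudgetTwoShellSeam.twoShellShapeV_of_pieces`) that is pure geometry: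

* `twoShellCover_holds : TwoShellCover (1/100) (3/50) (1/450)` — for every linear isometry `A` and every `p` with
  `1 ≤ ‖p‖ ≤ 3/2 + 1/450`, some rotated first-shell point `A u` is within `1/1.01 − 3/50` of `p`, or some rotated cap
  `A (u + v)` (`u, v` a square diagonal) is within `1/1.01² − 3/50`.  Proof: pull `p` back along `A` (an isometry of `E3` is onto),
  normalise, apply the direction lemmas of part 1 (`fcc_direction`, `hcp_direction`: inner product `≥ 4/5` with a shell direction or
  `≥ 57/50` with a cap direction) and convert the angular bound into a distance bound on the radial range `[1, 1.5023]`
  (worst case at the outer radius: `0.8532 < 0.8651 = (1/1.01 − 0.06)²`, `0.8317 < 0.8469 = (1/1.01² − 0.06)²`).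

* **THE NODE** `twoShellShapeV_of_G_P_Mboth`:
  `TwoShellShapeV (1/100) (3/50) (1/450) ⟸ LinkClassification (1/100) ∧ CapForcing (1/100) ∧ CappedRigidityBoth (1/100) η₁ η₂`
  (`η₁, η₂ ≤ 3/50`), and its finite-certificate form `twoShellShapeV_of_certs` (`LinkCert`, `CappedCertBoth` at fcc and hcp).
  `TwoShellShapeV` is the verbatim copy of lens-4's `OverbindingBudgetTwoShellShape.TwoShellShape` (slot 3 of the registered
  shell-hole cone `OverbindingBudgetShellHoleCone.rdef_of_ceg_shape_registered`); see the seam file for why the copy is needed today.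
No `sorry`, no new axioms, no `instance` / `notation`.
-/

noncomputable section

namespace Summit.AtomisticToContinuum.Crystallization.Theorems.OverbindingBudgetTwoShellCover

open scoped RealInnerProductSpace
open Literature.Geometry.DiscreteGeometry
open Summit.AtomisticToContinuum.Crystallization.Theorems.FrustratedLawDichotomyTwoShellRigidityCut
  (E3 LinkClassification CapForcing)
open Summit.AtomisticToContinuum.Crystallization.Theorems.FrustratedLawDichotomyTwoShellRigidityCells (CappedRigidityBoth)
open Summit.AtomisticToContinuum.Crystallization.Theorems.FrustratedLawDichotomyLinkCert (LinkCert linkClassification_of_linkCert)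
open Summit.AtomisticToContinuum.Crystallization.Theorems.FrustratedLawDichotomyCappedCertBoth
  (CappedCertBoth cappedRigidityBoth_of_certBoth)
open Summit.AtomisticToContinuum.Crystallization.Theorems.OverbindingBudgetTwoShellSeam
  (TwoShellShapeV TwoShellCoverAt TwoShellCover twoShellShapeV_of_pieces)
open Summit.AtomisticToContinuum.Crystallization.Theorems.OverbindingBudgetTwoShellCoverDirections
  (fcc_direction hcp_direction)

/-! ## §1 From inner products to distances -/

/-- Squared distance to a target `w` in terms of the radius `‖q‖` and the inner product of the normalised vector:
`‖q − w‖² = ‖q‖² − 2‖q‖·⟪‖q‖⁻¹•q, w⟫ + ‖w‖²`. [folklore] -/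
theorem norm_sub_sq_of_unit (q w : E3) (hq : ‖q‖ ≠ 0) :
    ‖q - w‖ ^ 2 = ‖q‖ ^ 2 - 2 * ‖q‖ * ⟪‖q‖⁻¹ • q, w⟫ + ‖w‖ ^ 2 := by
  rw [norm_sub_sq_real, real_inner_smul_left, ← mul_assoc, mul_assoc 2, mul_inv_cancel₀ hq, mul_one]

/-- A square diagonal of unit vectors is orthogonal: `‖u‖ = ‖v‖ = 1`, `dist u v = √2` ⟹ `‖u + v‖² = 2`. [folklore] -/
theorem norm_add_sq_eq_two {u v : E3} (hu : ‖u‖ = 1) (hv : ‖v‖ = 1) (huv : dist u v = Real.sqrt 2) : ‖u + v‖ ^ 2 = 2 := by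
  have h1 : ‖u - v‖ ^ 2 = 2 := by rw [← dist_eq_norm, huv, Real.sq_sqrt (by norm_num)]
  rw [norm_sub_sq_real, hu, hv] at h1
  rw [norm_add_sq_real, hu, hv]
  linarith

/-- **Shell conversion**: radius `r ∈ [1, 3/2 + 1/450]`, `⟪n, u⟫ ≥ 4/5` with `‖u‖ = 1` ⟹ `r² − 2r⟪n,u⟫ + 1 < (1/1.01 − 3/50)²`. [folklore] -/
theorem shell_numeric {r c : ℝ} (hr1 : 1 ≤ r) (hr2 : r ≤ 3 / 2 + 1 / 450) (hc : (4 : ℝ) / 5 ≤ c) :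
    r ^ 2 - 2 * r * c + 1 < (1 / (1 + 1 / 100) - 3 / 50) ^ 2 := by
  nlinarith [mul_nonneg (sub_nonneg.2 hr1) (sub_nonneg.2 hr2), mul_nonneg (sub_nonneg.2 hc) (by linarith : (0 : ℝ) ≤ r)]

/-- **Cap conversion**: radius `r ∈ [1, 3/2 + 1/450]`, `⟪n, u + v⟫ ≥ 57/50` with `‖u + v‖² = 2` ⟹
`r² − 2r⟪n,u+v⟫ + 2 < (1/1.01² − 3/50)²`. [folklore] -/
theorem cap_numeric {r c : ℝ} (hr1 : 1 ≤ r) (hr2 : r ≤ 3 / 2 + 1 / 450) (hc : (57 : ℝ) / 50 ≤ c) :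
    r ^ 2 - 2 * r * c + 2 < (1 / (1 + 1 / 100) ^ 2 - 3 / 50) ^ 2 := by
  nlinarith [mul_nonneg (sub_nonneg.2 hr1) (sub_nonneg.2 hr2), mul_nonneg (sub_nonneg.2 hc) (by linarith : (0 : ℝ) ≤ r)]

/-- **Coverage from the direction lemma** (any pattern of unit vectors). [this file] -/
theorem coverAt_of_directions {Pat : Finset E3} (hnorm : ∀ u ∈ Pat, ‖u‖ = 1)
    (hdir : ∀ n : E3, ‖n‖ = 1 →
      (∃ u ∈ Pat, ∃ v ∈ Pat, dist u v = Real.sqrt 2 ∧ (57 : ℝ) / 50 ≤ ⟪n, u + v⟫) ∨ (∃ u ∈ Pat, (4 : ℝ) / 5 ≤ ⟪n, u⟫)) :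
    TwoShellCoverAt (1 / 100) (3 / 50) (1 / 450) Pat := by
  intro A p hp1 hp2
  -- an isometry of `E3` is onto: pull `p` back
  obtain ⟨q, hq⟩ : ∃ q, A q = p := LinearMap.surjective_of_injective (f := A.toLinearMap) A.injective p
  subst hq
  have hqn : ‖A q‖ = ‖q‖ := A.norm_map q
  rw [hqn] at hp1 hp2
  have hq0 : ‖q‖ ≠ 0 := by linarith
  have hn1 : ‖‖q‖⁻¹ • q‖ = 1 := by rw [norm_smul, norm_inv, norm_norm, inv_mul_cancel₀ hq0]
  have hsub : ∀ w : E3, ‖A q - A w‖ = ‖q - w‖ := fun w => by rw [← map_sub, A.norm_map]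
  have hc1 : (0 : ℝ) < 1 / (1 + 1 / 100) - 3 / 50 := by norm_num
  have hc2 : (0 : ℝ) < 1 / (1 + 1 / 100) ^ 2 - 3 / 50 := by norm_num
  rcases hdir _ hn1 with ⟨u, hu, v, hv, huv, hin⟩ | ⟨u, hu, hin⟩
  · refine Or.inr ⟨u, hu, v, hv, huv, ?_⟩
    rw [hsub, ← pow_lt_pow_iff_left₀ (norm_nonneg _) hc2.le two_ne_zero, norm_sub_sq_of_unit q (u + v) hq0,
      norm_add_sq_eq_two (hnorm u hu) (hnorm v hv) huv]
    exact cap_numeric hp1 hp2 hin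
  · refine Or.inl ⟨u, hu, ?_⟩
    rw [hsub, ← pow_lt_pow_iff_left₀ (norm_nonneg _) hc1.le two_ne_zero, norm_sub_sq_of_unit q u hq0, hnorm u hu, one_pow]
    exact shell_numeric hp1 hp2 hin

/-! ## §2 The coverage piece and the node -/

/-- **THE COVERAGE PIECE, PROVED**: `TwoShellCover (1/100) (3/50) (1/450)`. [this file] -/
theorem twoShellCover_holds : TwoShellCover (1 / 100) (3 / 50) (1 / 450) :=
  ⟨coverAt_of_directions (fun _ hu => norm_eq_one_of_mem_fccKissingPattern hu) fcc_direction,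
    coverAt_of_directions (fun _ hu => norm_eq_one_of_mem_hcpKissingPattern hu) hcp_direction⟩

/-- **THE NODE (slot 3 of the shell-hole cone, produced from the FLD pieces)**:
`TwoShellShapeV (1/100) (3/50) (1/450) ⟸ G ∧ P ∧ M⁺` — `G = LinkClassification (1/100)` (link classification of charge-free sites),
`P = CapForcing (1/100)` (a link of links forces the six caps), `M⁺ = CappedRigidityBoth (1/100) η₁ η₂` with `η₁, η₂ ≤ 3/50`
(two-sided rigidity of the capped 18-point cluster).  The fourth piece, coverage, is `twoShellCover_holds`. [this file] -/
theorem twoShellShapeV_of_G_P_Mboth {η₁ η₂ : ℝ} (hη₁ : η₁ ≤ 3 / 50) (hη₂ : η₂ ≤ 3 / 50)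
    (hG : LinkClassification (1 / 100)) (hP : CapForcing (1 / 100)) (hM : CappedRigidityBoth (1 / 100) η₁ η₂) :
    TwoShellShapeV (1 / 100) (3 / 50) (1 / 450) :=
  twoShellShapeV_of_pieces le_rfl hη₁ hη₂ hG hP hM twoShellCover_holds

/-- **Finite-certificate form of the node**: the 12-point link certificate `LinkCert (1/100)`, cap forcing, and the two capped-cluster
certificates `CappedCertBoth (1/100) η₁ η₂` at fcc and hcp (`η₁, η₂ ≤ 3/50`) give `TwoShellShapeV (1/100) (3/50) (1/450)`. [this file] -/
theorem twoShellShapeV_of_certs {η₁ η₂ : ℝ} (hη₁ : η₁ ≤ 3 / 50) (hη₂ : η₂ ≤ 3 / 50) (hL : LinkCert (1 / 100))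
    (hP : CapForcing (1 / 100)) (hf : CappedCertBoth (1 / 100) η₁ η₂ fccKissingPattern)
    (hh : CappedCertBoth (1 / 100) η₁ η₂ hcpKissingPattern) : TwoShellShapeV (1 / 100) (3 / 50) (1 / 450) :=
  twoShellShapeV_of_G_P_Mboth hη₁ hη₂ (linkClassification_of_linkCert hL) hP (cappedRigidityBoth_of_certBoth hf hh)

end Summit.AtomisticToContinuum.Crystallization.Theorems.OverbindingBudgetTwoShellCover

end
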